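import Literature.AlgebraicGeometry.Resolution.BlowupSequences
import Literature.AlgebraicGeometry.Resolution.StrictTransformCurveDelta
import Literature.AlgebraicGeometry.Resolution.PointBlowupHsFunMono
import Literature.AlgebraicGeometry.Resolution.HilbertSamuelLowerBound
import Literature.AlgebraicGeometry.Resolution.BlowupReducedDimension
import Literature.AlgebraicGeometry.Resolution.HilbertSamuelIsolatedSingularities
import Literature.AlgebraicGeometry.Resolution.ExcellentRingsFieldProofs
import Mathlib.AlgebraicGeometry.Morphisms.Proper
import Mathlib.AlgebraicGeometry.Noetherian
import HarnessLib

/-!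
# `SigmaMaxModifications` (crux stmt-ResolutionOfSingularities-18506, line `Sketch`):
# stub `nuEliminationsExist_integral_curve` — `ν`-eliminations of integral curves, `N ≥ 2`

Stub `nuEliminationsExist_integral_curve` of the lead skeleton `Sketch` for the crux
`Summit.ResolutionOfSingularities.ResolutionOfSingularities.Theses.HilbertSamuelElimination.SigmaMaxModifications`:
the open core `stub_nuEliminationsExist` (CJS, LNM 2270, Def. 6.14: for a maximal value
`ν ≠ Φ^{(N)}` of `Σ_X` a blow-up sequence with centres over `X(ν)`, `H^N` non-increasing, after
which `ν` is no longer a value) in the classical case of an INTEGRAL scheme `X` of dimension `≤ 1`,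
locally of finite type and quasi-compact over a field `k`, at every level `N ≥ 2`.

Proof (Kollár 2007, §1.4: "blowing up singular points of a curve terminates, the `δ`-invariant
drops"): strong induction on the total `δ`-invariant `Σ_y δ(𝒪_{X,y}) < ∞`
(`finite_support_pointDelta`, `pointDelta_ne_top` for quasi-excellent curves,
`QuasiExcellentCurveDelta.lean`). A point `x ∈ X(ν)` is singular (`H^N_X(x) = Φ^{(N)}` exactly at
the regular points with `dim 𝒪_{X,x} ≤ N`, `Scheme.hsFun_eq_iterPSum_Phi_iff`, CJS Lemma 2.31),
hence closed with `dim 𝒪_{X,x} = 1` and `𝒪_{X,x}` not a discrete valuation ring. Blow up the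
reduced point `x` (`blowup (𝓘_{{x}})`, `BlowupSequences.lean`): the blow-up `X₁` is again an
integral curve of finite type over `k`, `H^N_{X₁}(x') ≤ H^N_X(π x')` at every point
(`IsBlowup.hsFun_le_of_isClosed_point_centre_of_locallyOfFiniteType`, CJS Thm. 3.10 (1) for a
closed-point centre, which needs `N > ψ_X(x)`, i.e. `N ≥ 2`), and `δ(X₁) < δ(X)`
(`IsBlowup.finsum_pointDelta_lt_of_vanishingIdeal`). By maximality of `ν` and the monotonicity,
`ν` stays maximal in `Σ_{X₁}` unless it disappeared, and `X₁(ν) ⊆ π⁻¹ X(ν)`; recurse.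
-/

set_option linter.dupNamespace false -- mandated namespace of this single-conjunct summit

noncomputable section

open CategoryTheory AlgebraicGeometry TopologicalSpace
open Literature.AlgebraicGeometry.Resolution Literature.RingTheory.HilbertSamuel

namespace Summit.ResolutionOfSingularities.ResolutionOfSingularities.Theorems.SigmaMaxModifications.Sketch

/-! ## The measure: the total `δ`-invariant of a quasi-excellent integral curve is finite -/

/-- The total `δ`-invariant `Σ_y δ(𝒪_{X,y})` of an integral Noetherian quasi-excellent scheme of
dimension `≤ 1` is finite (finite support, finite values). [cite: Kollar2007, §1.4] -/
private theorem finsum_pointDelta_ne_top_of_curve {X : Scheme.{0}} [IsIntegral X] [IsNoetherian X]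
    (hqe : Scheme.IsQuasiExcellent X) (hdim : topologicalKrullDim X ≤ 1) :
    ∑ᶠ y, pointDelta X y ≠ ⊤ := by
  rw [finsum_eq_sum _
    (_root_.Literature.AlgebraicGeometry.Resolution.finite_support_pointDelta hqe hdim)]
  exact ENat.sum_ne_top.mpr fun y _ => pointDelta_ne_top hqe hdim y

/-! ## The induction on the total `δ`-invariant -/

/-- **`ν`-eliminations of integral curves, by strong induction on the total `δ`-invariant**
`n = Σ_y δ(𝒪_{X,y})`: blow up a (closed, singular) point of `X(ν)`; `H^N` does not increase
(CJS Thm. 3.10 (1) for closed-point centres, `N ≥ 2 > ψ_X(x)`), `δ` drops (Kollár 2007, §1.4),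
and `ν` stays maximal upstairs unless it disappeared. [cite: CossartJannsenSaito2020, Def. 6.14]
[cite: Kollar2007, §1.4] -/
private theorem nuEliminationsExist_integral_curve_aux (k : Type) [Field k] {N : ℕ} (hN : 2 ≤ N)
    (n : ℕ) : ∀ (X : Scheme.{0}) (f : X ⟶ Spec (.of k)) [LocallyOfFiniteType f] [QuasiCompact f]
      [IsIntegral X], topologicalKrullDim X ≤ 1 → (∑ᶠ y, pointDelta X y).toNat = n →
      ∀ ν : ℕ → ℕ, Maximal (· ∈ Scheme.hsValues X N) ν → ν ≠ iterPSum N Phi →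
        ∃ s : CentreSeq X, s.CentresOver (Scheme.hsStratum X N ν) ∧
          (∀ x' : s.top, Scheme.hsFun s.top N x' ≤ Scheme.hsFun X N (s.comp.base x')) ∧
          ν ∉ Scheme.hsValues s.top N := by
  induction n using Nat.strong_induction_on with | _ n ih =>
  intro X f hft hqc hint hdim hδ ν hν hνΦ
  -- (0) setting: `X` is Noetherian and quasi-excellent
  haveI : IsLocallyNoetherian X := LocallyOfFiniteType.isLocallyNoetherian f
  haveI : IsNoetherian X := Scheme.isNoetherian_of_finiteType_over_field f
  have hqe : Scheme.IsQuasiExcellent X :=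
    Scheme.isQuasiExcellent_of_locallyOfFiniteType Stacks07QW_field_holds f
  -- (2) a point `x ∈ X(ν)`: singular, closed, `dim 𝒪_{X,x} = 1`, not a DVR
  obtain ⟨x, hx⟩ := hν.1
  have hdimx : ringKrullDim (X.presheaf.stalk x) ≤ (N : WithBot ℕ∞) :=
    (ringKrullDim_stalk_le_one hdim x).trans (by exact_mod_cast (show 1 ≤ N by omega))
  have hxreg : x ∉ Scheme.regularLocus X := fun hreg =>
    hνΦ (hx.symm.trans ((Scheme.hsFun_eq_iterPSum_Phi_iff N x).mpr ⟨hreg, hdimx⟩))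
  have h1 : ringKrullDim (X.presheaf.stalk x) = 1 :=
    (isField_or_ringKrullDim_eq_one hdim x).resolve_left fun hF =>
      hxreg (isRegularLocalRing_of_isField hF)
  have hsing : ¬ IsDiscreteValuationRing (X.presheaf.stalk x) := fun hdvr =>
    hxreg (show IsRegularLocalRing (X.presheaf.stalk x) from inferInstance)
  have hxcl : IsClosed ({x} : Set X) := by
    have hcl : IsClosed (Scheme.regularLocus X)ᶜ :=
      (Scheme.isOpen_regularLocus_of_isQuasiExcellent hqe).isClosed_compl
    have hne : (Scheme.regularLocus X)ᶜ ≠ Set.univ := fun h =>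
      (h.symm ▸ Set.mem_univ (genericPoint X) : genericPoint X ∈ (Scheme.regularLocus X)ᶜ)
        (genericPoint_mem_regularLocus X)
    exact (Set.finite_and_isClosed_singleton_of_dim_le_one hdim hcl hne).2 x hxreg
  have hψN : Scheme.hsPsi X x < N :=
    lt_of_le_of_lt (Scheme.hsPsi_le x (d := 1) (by exact_mod_cast h1)) (by omega)
  -- (3) blow up the reduced closed point `x`
  obtain ⟨C, hC⟩ : ∃ C : X.IdealSheafData,
      C = Scheme.IdealSheafData.vanishingIdeal ⟨{x}, hxcl⟩ := ⟨_, rfl⟩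
  have hρ : IsBlowup (blowup.π C) (Scheme.IdealSheafData.vanishingIdeal ⟨{x}, hxcl⟩) := by
    rw [← hC]; exact blowup.isBlowup C
  have hCsupp : (C.support : Set X) = {x} := by
    rw [hC]; exact Scheme.IdealSheafData.coe_support_vanishingIdeal _
  have hC0 : C ≠ ⊥ := by
    rw [hC]
    exact vanishingIdeal_ne_bot_of_subset_compl_regularLocus (Set.singleton_subset_iff.mpr hxreg)
  haveI : IsIntegral (blowup C) := (blowup.isBlowup C).isIntegral hC0
  haveI : IsProper (blowup.π C) := (blowup.isBlowup C).isProper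
  haveI : IsLocallyNoetherian (blowup C) := LocallyOfFiniteType.isLocallyNoetherian (blowup.π C)
  haveI : IsNoetherian (blowup C) :=
    Scheme.isNoetherian_of_finiteType_over_field (blowup.π C ≫ f)
  have hqe₁ : Scheme.IsQuasiExcellent (blowup C) := (blowup.isBlowup C).isQuasiExcellent hqe
  have hdim₁ : topologicalKrullDim (blowup C) ≤ 1 :=
    (blowup.isBlowup C).topologicalKrullDim_le_of_isLocallyNoetherian hdim
  -- (4) `H^N` does not increase (point-centre Bennett, `N > ψ_X(x)`)
  have hmono₁ : ∀ x' : blowup C,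
      Scheme.hsFun (blowup C) N x' ≤ Scheme.hsFun X N ((blowup.π C).base x') := fun x' =>
    hρ.hsFun_le_of_isClosed_point_centre_of_locallyOfFiniteType f hxcl N hψN x'
  -- (5) the total `δ`-invariant drops
  haveI := module_finite_integralClosure_stalk hqe hdim x
  have hfin : ∀ x' : blowup C, blowup.π C x' = x → Module.Finite ((blowup C).presheaf.stalk x')
      (integralClosure ((blowup C).presheaf.stalk x') (blowup C).functionField) :=
    fun x' _ => module_finite_integralClosure_stalk hqe₁ hdim₁ x'
  obtain ⟨-, hlt⟩ := IsBlowup.finsum_pointDelta_lt_of_vanishingIdeal hxcl hρ h1 hfin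
    (_root_.Literature.AlgebraicGeometry.Resolution.finite_support_pointDelta hqe hdim)
    (pointDelta_ne_top hqe hdim) hsing
  have htop : ∑ᶠ y, pointDelta X y ≠ ⊤ := finsum_pointDelta_ne_top_of_curve hqe hdim
  have hm : (∑ᶠ y', pointDelta (blowup C) y').toNat < n := by
    rw [← hδ]
    have key : ((∑ᶠ y', pointDelta (blowup C) y').toNat : ℕ∞) <
        ((∑ᶠ y, pointDelta X y).toNat : ℕ∞) := by
      rwa [ENat.coe_toNat hlt.ne_top, ENat.coe_toNat htop]
    exact_mod_cast key
  -- maximality of `ν` and monotonicity: values `≥ ν` upstairs lie over `X(ν)` and equal `ν`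
  have hdown : ∀ y : blowup C, ν ≤ Scheme.hsFun (blowup C) N y →
      Scheme.hsFun X N ((blowup.π C).base y) = ν ∧ Scheme.hsFun (blowup C) N y = ν := by
    intro y hy
    have hge : ν ≤ Scheme.hsFun X N ((blowup.π C).base y) := hy.trans (hmono₁ y)
    have hle : Scheme.hsFun X N ((blowup.π C).base y) ≤ ν := hν.2 ⟨_, rfl⟩ hge
    exact ⟨le_antisymm hle hge, le_antisymm ((hmono₁ y).trans hle) hy⟩
  have hC_over : (C.support : Set X) ⊆ Scheme.hsStratum X N ν := by
    rw [hCsupp]; exact Set.singleton_subset_iff.mpr hx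
  -- (6) recurse
  by_cases hcase : ν ∈ Scheme.hsValues (blowup C) N
  · have hν₁ : Maximal (· ∈ Scheme.hsValues (blowup C) N) ν := by
      refine ⟨hcase, ?_⟩
      rintro μ ⟨y, rfl⟩ hνμ
      exact (hdown y hνμ).2.le
    obtain ⟨s₁, hover₁, hmono_s₁, hkill₁⟩ :=
      ih _ hm (blowup C) (blowup.π C ≫ f) hdim₁ rfl ν hν₁ hνΦ
    refine ⟨CentreSeq.cons C s₁, (CentreSeq.centresOver_cons C s₁ _).mpr
      ⟨hC_over, CentreSeq.CentresOver.mono s₁ (fun y hy => ?_) hover₁⟩, fun x' => ?_, hkill₁⟩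
    · exact (hdown y (Eq.le (Eq.symm hy))).1
    · show Scheme.hsFun s₁.top N x' ≤
        Scheme.hsFun X N ((blowup.π C).base (s₁.comp.base x'))
      exact (hmono_s₁ x').trans (hmono₁ _)
  · refine ⟨CentreSeq.cons C (CentreSeq.nil _), (CentreSeq.centresOver_cons C _ _).mpr
      ⟨hC_over, CentreSeq.centresOver_nil _ _⟩, fun x' => ?_, hcase⟩
    show Scheme.hsFun (blowup C) N x' ≤
      Scheme.hsFun X N ((𝟙 (blowup C) ≫ blowup.π C).base x')
    rw [Category.id_comp]
    exact hmono₁ x'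

/-! ## The stub -/

/-- **`ν`-ELIMINATIONS EXIST FOR INTEGRAL CURVES at every level `N ≥ 2`** (the open core
`stub_nuEliminationsExist` of the line `Sketch`, CJS Def. 6.14 with Thm. 3.10 (1), in the
classical one-dimensional integral case): for `X` an integral scheme of dimension `≤ 1`, locally
of finite type and quasi-compact over a field `k`, `N ≥ 2`, and a maximal value `ν ≠ Φ^{(N)}` of
`Σ_X = {H^N_X(x)}`, there is a finite sequence of blow-ups `s : CentreSeq X` (in closed singular
points) whose centres lie over the stratum `X(ν)`, along whose composite `H^N` does not increase,
and after which `ν` is no longer a value — blowing up singular points of a curve terminates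
because the total `δ`-invariant drops (Kollár 2007, §1.4). [cite: CossartJannsenSaito2020, Def. 6.14]
[cite: Kollar2007, §1.4] -/
theorem nuEliminationsExist_integral_curve :
    ∀ (k : Type) [Field k] (X : Scheme.{0}) (f : X ⟶ Spec (.of k)), LocallyOfFiniteType f →
      QuasiCompact f → IsIntegral X → topologicalKrullDim X ≤ 1 → ∀ N : ℕ, 2 ≤ N →
      ∀ ν : ℕ → ℕ, Maximal (· ∈ Scheme.hsValues X N) ν → ν ≠ iterPSum N Phi →
        ∃ s : CentreSeq X, s.CentresOver (Scheme.hsStratum X N ν) ∧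
          (∀ x' : s.top, Scheme.hsFun s.top N x' ≤ Scheme.hsFun X N (s.comp.base x')) ∧
          ν ∉ Scheme.hsValues s.top N := by
  intro k _ X f hft hqc hint hdim N hN ν hν hνΦ
  exact nuEliminationsExist_integral_curve_aux k hN _ X f hdim rfl ν hν hνΦ

end Summit.ResolutionOfSingularities.ResolutionOfSingularities.Theorems.SigmaMaxModifications.Sketch

end
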